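import Literature.MathematicalPhysics.QuantumFieldTheory.Balaban1983to89.B8Prop6CubeMemberNormsAt
import Literature.MathematicalPhysics.QuantumFieldTheory.Balaban1983to89.B8Prop3KLevelBdry

/-!
# `Balaban1983to89.B8Prop6CubeMemberNormsBdry` — [Balaban1985RegularSpaces] PROPOSITION 3 (p. 87) AT THE CONCRETE CUBE MEMBER OF (1.131),
# BACKGROUND `1`: the norm members of (1.136), the Prop.-3-frame b9 socket IN THE REPAIRED CURRENCY (exterior-collar term, located repair R-d)

statement-level skeleton of published theorems with citation tags; proofs where landed; nothing here is a claim about the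
Yang–Mills mass gap

PDF held: `paper:balaban1985-cmp99-regular-spaces-gauge-fixing` (journal page = PDF page + 74); pp. 83, 86–87, 98–99.

CITATION HEADER (lean-in-tree rule).  Cell `pub-ymgap` (YM Track A, HUMAN RULING D-0062), DAG node N05 = [B8], seat `pub-ymgap-dag-n05-e`
(R141 (C) fan-out, row s3b), generation g6 — the Proposition-3 half of the located repair R-d at the cube member (Theorem-4 half:
`B8Prop3GaugeFixedKLevelBdry` ∕ `B8Thm4SupportLocalBdry` ∕ `B8Thm4ConcreteBdry` ∕ `B8LeafModelZd3Bdry`).  WHY: the gradient ∕ `∂*∂` ∕ `Δ`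
members of Proposition 6's (1.136) at the cube member were derived (`B8Prop6CubeMemberNormsAt`, this seat's g0) from the Prop.-3-frame b9
socket `SockB9P3` AT THE MEMBER — certified false there (this seat's g5, `B8JunctionH59Vacuity.not_sockB9P3_allLevels_cubeMember`; the same
corner datum refutes the top-level clause).  In Proposition 3's abstract frame the exterior collar is bounded only by (1.41)'s `α₂` and the
repair could not keep the constant; AT THE CUBE DATUM it can: on the collar the gauge transformation is trivial and `A = (1∕iη) log U₀″`
with `‖U₀″ − 1‖ ≤ 6dL²Mα₀` on every bond ((1.133)₀, (1.130)).  THIS FILE re-runs the g0 theorem on the repaired socket (inline), with the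
support clause, absorbing the collar allowance in the slack of (1.60) ⇒ (1.62).  Kind «kernel-checked proof», theorems only, no `def`.

HONEST SCOPE.  (i) By-name re-run of the landed assembly (n05-b's (1.55)∕(1.56) engines, `B8Prop3KLevelBdry`'s bootstrap); the repaired
socket is a HYPOTHESIS ([4] Thm 3.3 for `G(1)`, `H(1)` on the finite cube family WITH exterior data) — weaker than the refuted `SockB9P3`,
NOT discharged.  (ii) The Hölder member of (1.36) is not concluded (its bootstrap `B8Prop3Holder` would need the same allowance; not needed by
`GaugedBoundB8`).  (iii) `B_∂`, `4B_∂ ≤ (dL − 1)B₀` are the tree's.  Count-neutral; N05 NOT discharged; one finite `𝕋⁴` programme at fixed `ε`,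
Bałaban as printed; nothing continuum ∕ ℝ⁴ ∕ OS ∕ mass-gap ∕ Clay.  Unit `pub-ymgap-dag-n05-e` (g6), 2026-08-27.
-/

noncomputable section

open NormedSpace

namespace Literature.MathematicalPhysics.QuantumFieldTheory.Balaban1983to89.B8Prop6CubeMemberNormsBdry

open MatrixLog B7Prop1Explicit B7Prop2Explicit B7Prop1Local B7Eq92Concrete
open B7Prop2Explicit (C0 c2')
open B7Prop3Flat (c3)
open B7Prop4GeneralLevels (logCovIter linCovIter)
open B8Ineq132 (covDerivFwd InAk inAk_gaugeAct_iff BondTouches)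
open B8Ineq133 (cutFixed)
open B8Lemma1NonAbelian (mulCfg)
open B8Eq115GaugeFixing (gaugeAct_mul gaugeAct_mem_of)
open B8Eq146AExpansion (iEta expCfg plaqCovDeriv)
open B8Eq143PlaqExpansion (pdiv)
open B8Eq184Proof (cfgExp)
open B8Eq140Level (SideTouches)
open B8Eq119TwistedAxial (InAx Restr129)
open B8Eq155JBound (Jcur wsup)
open B8ScaledSupNorm (bondNorm msup weight Bdd)
open B8Eq138LandauZd (IsLandau138W logCfg covLap)
open B8Eq131Cubes (tcube tLo tHi ctr)
open B8Eq131CubesAdmissible (cubeFam)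
open B8CubeMemberZd (cubeLamS cubeLamB hbox_cubeLamB)
open B8Prop6CubeMember (thm4_hypotheses_one_cutFixed regime_of_printed_smallness norm_cutFixed_sub_one_le)
open B8Prop6OfThm4 (const_136)
open B8Prop3GaugeFixedKLevel (inAk_congr_of_sideTouches expCfg_iEta_eq_cfgExp)
open B8LeafModelZd3 (mlogCfg mlogCfg_spec mlogCfg_of_sideTouches mlogCfg_of_not prop3_windows)
open B9Eq340HolderZd (hquot AdmPair)
open B8Prop6CubeMemberNorms (c137_cubeMember ineq161_of_small)

-- `Site` alone could resolve to the torus sites of `Setup.lean`; re-export the `ℤ^d` sites of `B7Prop1Explicit`.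
export B7Prop1Explicit (Site)

variable {d : ℕ}

variable {𝔸 : Type} [CStarAlgebra 𝔸] [Nontrivial 𝔸]

/-! ## §1 Proposition 3 at the member, the repaired b9 socket at the member only -/

/-- **PROPOSITION 3 (p. 87) AT THE CONCRETE CUBE MEMBER, BACKGROUND `1`, THE b9 SOCKET IN THE REPAIRED CURRENCY: THE NORM MEMBERS OF
(1.136)** — this seat's g0 `B8Prop6CubeMemberNormsAt.norms136_cubeMember_at` with (i) the Prop.-3-frame b9 socket at the member stated INLINE
with the exterior-collar term `+ B_∂·Φ₀(A′)` on every (1.59) line (the `SockB9P3` shape is certified false at the member, `B8JunctionH59Vacuity`),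
(ii) the support clause «`u = 1` off `□₀`» on the gauge transformation (Theorem 4 delivers it), (iii) the side condition `0 ≤ B_∂`,
`4B_∂ ≤ (dL − 1)B₀`.  On the collar `W = U₀″`, so `η‖A‖ ≤ 2‖U₀″ − 1‖ ≤ 12dL²Mα₀` ((1.133)₀ on every bond, n05-c's `norm_cutFixed_sub_one_le`),
and the allowances fit the slack of (1.60) ⇒ (1.62) (`B8Prop3KLevelBdry`): SAME constants `5dLB₀·s` for `|∇^ηA|₍₋₂₎`, `|∂^{η*}∂^ηA|₍₋₃₎`,
`|Δ^ηA|₍₋₃₎` (the Hölder member is not concluded here).  Proof = the landed one verbatim + the collar estimate + the four-member bootstrap.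
[cite: Balaban1985RegularSpaces, Prop. 3 p.87, Prop. 6 (1.136) p.99, (1.40)–(1.42) p.83, (1.58)–(1.61) p.86, (1.133) p.99] -/
theorem norms136_cubeMember_at_bdry (hd2 : 2 ≤ d) {L : ℕ} (hL : 2 ≤ L) {B₀ B₀β C₂ cB9 Bbd : ℝ} (hB₀ : 0 < B₀)
    (hC₂ : 2097152 * ((d : ℝ) + 1) ^ 2 ≤ C₂) (hcB9 : 0 < cB9) (hBbd : 0 ≤ Bbd) (hBd : 4 * Bbd ≤ ((d : ℝ) * L - 1) * B₀) (β : ℝ) (len : Site d → ℝ) :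
    ∃ c : ℝ, 0 < c ∧ ∀ (η : ℝ), 0 < η → ∀ (k : ℕ), 1 ≤ k → ∀ (a : Site d) (M ρ : ℕ), L ≤ ρ → ρ ≤ M → 11 * (d : ℝ) < M →
      -- the Prop.-3-frame b9 socket AT THE MEMBER, IN THE REPAIRED CURRENCY (exterior-collar term on every line)
      (∀ α₀ α₂ : ℝ, 0 < α₀ → α₀ ≤ cB9 → 0 < α₂ → α₂ ≤ cB9 →
      ∀ (U₀ W : Site d → Fin d → 𝔸ˣ), (∀ x κ, U₀ x κ ∈ unitaryUnits 𝔸) → (∀ x κ, W x κ ∈ unitaryUnits 𝔸) →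
      InAk L k η α₀ (cubeFam false L a M ρ k) U₀ → InAk L k η α₀ (cubeFam false L a M ρ k) (mulCfg W U₀) → IsLandau138W L k η ((cubeFam false L a M ρ k) 0) (cubeLamS L a M ρ k k) U₀ W →
      ∀ A' : Site d → Fin d → 𝔸, (∀ y τ, IsSelfAdjoint (A' y τ)) →
      (∀ j, j ≤ k → ∀ (y : Site d) (τ : Fin d), SideTouches ((cubeFam false L a M ρ k) j) y τ →
      W y τ = cfgExp η A' y τ ∧ ‖A' y τ‖ ≤ α₂ * ((L : ℝ) ^ j * η)⁻¹) →
      (∀ (y : Site d) (τ : Fin d), (∀ j, j ≤ k → ¬ SideTouches ((cubeFam false L a M ρ k) j) y τ) → A' y τ = 0) →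
      msup L k η (-(1 : ℝ)) (fun j (b : Site d × Fin d) => SideTouches ((cubeFam false L a M ρ k) j) b.1 b.2) (fun b => A' b.1 b.2)
      ≤ B₀ * (bondNorm L k η (-(3 : ℝ)) (cubeFam false L a M ρ k) (fun x μ => Jcur η U₀ A' μ x)
      + wsup 1 (fun p : {p : ℕ × (Site d × Fin d) // p.1 ≤ k ∧ p.2 ∈ cubeLamB L a M ρ k k p.1} =>
      linCovIter L U₀ (iEta η A') p.1.1 p.1.2.1 p.1.2.2)) + Bbd * msup L k η (-(1 : ℝ))
      (fun j (b : Site d × Fin d) => j = 0 ∧ SideTouches ((cubeFam false L a M ρ k) 0) b.1 b.2 ∧ ¬ BondTouches ((cubeFam false L a M ρ k) 0) b.1 b.2)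
      (fun b => A' b.1 b.2) ∧
      msup L k η (-(2 : ℝ)) (fun j (t : Fin d × Fin d × Site d) => SideTouches ((cubeFam false L a M ρ k) j) t.2.2 t.2.1)
      (fun t => covDerivFwd η U₀ t.1 (fun z => A' z t.2.1) t.2.2)
      ≤ B₀ * (bondNorm L k η (-(3 : ℝ)) (cubeFam false L a M ρ k) (fun x μ => Jcur η U₀ A' μ x)
      + wsup 1 (fun p : {p : ℕ × (Site d × Fin d) // p.1 ≤ k ∧ p.2 ∈ cubeLamB L a M ρ k k p.1} =>
      linCovIter L U₀ (iEta η A') p.1.1 p.1.2.1 p.1.2.2)) + Bbd * msup L k η (-(1 : ℝ))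
      (fun j (b : Site d × Fin d) => j = 0 ∧ SideTouches ((cubeFam false L a M ρ k) 0) b.1 b.2 ∧ ¬ BondTouches ((cubeFam false L a M ρ k) 0) b.1 b.2)
      (fun b => A' b.1 b.2) ∧
      bondNorm L k η (-(3 : ℝ)) (cubeFam false L a M ρ k) (fun x μ => pdiv η U₀ (plaqCovDeriv η U₀ A') μ x)
      ≤ B₀ * (bondNorm L k η (-(3 : ℝ)) (cubeFam false L a M ρ k) (fun x μ => Jcur η U₀ A' μ x)
      + wsup 1 (fun p : {p : ℕ × (Site d × Fin d) // p.1 ≤ k ∧ p.2 ∈ cubeLamB L a M ρ k k p.1} =>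
      linCovIter L U₀ (iEta η A') p.1.1 p.1.2.1 p.1.2.2)) + Bbd * msup L k η (-(1 : ℝ))
      (fun j (b : Site d × Fin d) => j = 0 ∧ SideTouches ((cubeFam false L a M ρ k) 0) b.1 b.2 ∧ ¬ BondTouches ((cubeFam false L a M ρ k) 0) b.1 b.2)
      (fun b => A' b.1 b.2) ∧
      bondNorm L k η (-(3 : ℝ)) (cubeFam false L a M ρ k) (fun x μ => covLap η U₀ (fun z => A' z μ) x)
      ≤ B₀ * (bondNorm L k η (-(3 : ℝ)) (cubeFam false L a M ρ k) (fun x μ => Jcur η U₀ A' μ x)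
      + wsup 1 (fun p : {p : ℕ × (Site d × Fin d) // p.1 ≤ k ∧ p.2 ∈ cubeLamB L a M ρ k k p.1} =>
      linCovIter L U₀ (iEta η A') p.1.1 p.1.2.1 p.1.2.2)) + Bbd * msup L k η (-(1 : ℝ))
      (fun j (b : Site d × Fin d) => j = 0 ∧ SideTouches ((cubeFam false L a M ρ k) 0) b.1 b.2 ∧ ¬ BondTouches ((cubeFam false L a M ρ k) 0) b.1 b.2)
      (fun b => A' b.1 b.2) ∧
      msup L k η (-(2 + β)) (fun j (q : Fin d × Fin d × (Site d × Site d)) => q.2.2 ∈ AdmPair η len ∧ q.2.2.1 ∈ (cubeFam false L a M ρ k) j)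
      (fun q => hquot η β len U₀ (covDerivFwd η U₀ q.1 (fun z => A' z q.2.1)) q.2.2)
      ≤ B₀β * (bondNorm L k η (-(3 : ℝ)) (cubeFam false L a M ρ k) (fun x μ => Jcur η U₀ A' μ x)
      + wsup 1 (fun p : {p : ℕ × (Site d × Fin d) // p.1 ≤ k ∧ p.2 ∈ cubeLamB L a M ρ k k p.1} =>
      linCovIter L U₀ (iEta η A') p.1.1 p.1.2.1 p.1.2.2)) + Bbd * msup L k η (-(1 : ℝ))
      (fun j (b : Site d × Fin d) => j = 0 ∧ SideTouches ((cubeFam false L a M ρ k) 0) b.1 b.2 ∧ ¬ BondTouches ((cubeFam false L a M ρ k) 0) b.1 b.2)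
      (fun b => A' b.1 b.2)) →
      ∀ (U₀ : Site d → Fin d → 𝔸ˣ), (∀ x κ, U₀ x κ ∈ unitaryUnits 𝔸) → ∀ (α₀ : ℝ), 0 < α₀ →
      C0 d * (α₀ * (L : ℝ) ^ 2) ≤ 1 / 3 → 2 * (α₀ * (L : ℝ) ^ 2) ≤ c2' d L →
      ∀ (Ω : ℕ → Set (Site d)), InAk L k η α₀ Ω U₀ → tcube L a M ρ k ⊆ Ω (k - 1) →
      11 * (d : ℝ) ^ 2 * (L : ℝ) ^ 2 * α₀ + ((M : ℝ) + 4 * ρ) * d * (L : ℝ) ^ 2 * α₀ ≤ 1 / 6 →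
      (L : ℝ) ^ 3 * α₀ ≤ c → 5 * (d : ℝ) * L * B₀ * ((L : ℝ) ^ 3 * α₀ + 6 * d * (L : ℝ) ^ 2 * M * α₀) ≤ c →
      2 * (5 * (d : ℝ) * L * B₀ * ((L : ℝ) ^ 3 * α₀ + 6 * d * (L : ℝ) ^ 2 * M * α₀)) ^ 2
        + 20 * d * ((L : ℝ) ^ 3 * α₀) * (5 * (d : ℝ) * L * B₀ * ((L : ℝ) ^ 3 * α₀ + 6 * d * (L : ℝ) ^ 2 * M * α₀))
        + 2 * C₂ * (5 * (d : ℝ) * L * B₀ * ((L : ℝ) ^ 3 * α₀ + 6 * d * (L : ℝ) ^ 2 * M * α₀)) ^ 2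
        ≤ (L : ℝ) ^ 3 * α₀ + 6 * d * (L : ℝ) ^ 2 * M * α₀ →
      (d : ℝ) * L * (6 * d * (L : ℝ) ^ 2 * M * α₀) ≤ 1 / 8 →
      ∀ (u : Site d → 𝔸ˣ), (∀ x, u x ∈ unitaryUnits 𝔸) → (∀ x, x ∉ cubeFam false L a M ρ k 0 → u x = 1) →
      Restr129 L k (cubeLamS L a M ρ k k) (1 : Site d → Fin d → 𝔸ˣ) u →
      IsLandau138W L k η (cubeFam false L a M ρ k 0) (cubeLamS L a M ρ k k) (1 : Site d → Fin d → 𝔸ˣ)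
        (gaugeAct u⁻¹ (cutFixed L (tLo a ρ) (tHi a M ρ) U₀ k (ctr a M))) →
      (∀ j, j ≤ k → ∀ b ∈ {b : Site d × Fin d | SideTouches (cubeFam false L a M ρ k j) b.1 b.2},
        gaugeAct u⁻¹ (cutFixed L (tLo a ρ) (tHi a M ρ) U₀ k (ctr a M)) b.1 b.2 =
            cfgExp η (logCfg η (gaugeAct u⁻¹ (cutFixed L (tLo a ρ) (tHi a M ρ) U₀ k (ctr a M)))) b.1 b.2 ∧
          IsSelfAdjoint (logCfg η (gaugeAct u⁻¹ (cutFixed L (tLo a ρ) (tHi a M ρ) U₀ k (ctr a M))) b.1 b.2) ∧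
          ‖logCfg η (gaugeAct u⁻¹ (cutFixed L (tLo a ρ) (tHi a M ρ) U₀ k (ctr a M))) b.1 b.2‖ ≤
            (5 * (d : ℝ) * L * B₀ * ((L : ℝ) ^ 3 * α₀ + 6 * d * (L : ℝ) ^ 2 * M * α₀)) * ((L : ℝ) ^ j * η)⁻¹) →
      msup L k η (-(2 : ℝ)) (fun j (t : Fin d × Fin d × Site d) => SideTouches (cubeFam false L a M ρ k j) t.2.2 t.2.1)
          (fun t => covDerivFwd η (1 : Site d → Fin d → 𝔸ˣ) t.1 (fun z => mlogCfg k η (cubeFam false L a M ρ k)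
            (gaugeAct u⁻¹ (cutFixed L (tLo a ρ) (tHi a M ρ) U₀ k (ctr a M))) z t.2.1) t.2.2)
        ≤ 5 * (d : ℝ) * L * B₀ * ((L : ℝ) ^ 3 * α₀ + 6 * d * (L : ℝ) ^ 2 * M * α₀) ∧
      bondNorm L k η (-(3 : ℝ)) (cubeFam false L a M ρ k) (fun x μ => pdiv η (1 : Site d → Fin d → 𝔸ˣ)
          (plaqCovDeriv η (1 : Site d → Fin d → 𝔸ˣ) (mlogCfg k η (cubeFam false L a M ρ k)
            (gaugeAct u⁻¹ (cutFixed L (tLo a ρ) (tHi a M ρ) U₀ k (ctr a M))))) μ x)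
        ≤ 5 * (d : ℝ) * L * B₀ * ((L : ℝ) ^ 3 * α₀ + 6 * d * (L : ℝ) ^ 2 * M * α₀) ∧
      bondNorm L k η (-(3 : ℝ)) (cubeFam false L a M ρ k) (fun x μ => covLap η (1 : Site d → Fin d → 𝔸ˣ)
          (fun z => mlogCfg k η (cubeFam false L a M ρ k) (gaugeAct u⁻¹ (cutFixed L (tLo a ρ) (tHi a M ρ) U₀ k (ctr a M))) z μ) x)
        ≤ 5 * (d : ℝ) * L * B₀ * ((L : ℝ) ^ 3 * α₀ + 6 * d * (L : ℝ) ^ 2 * M * α₀) := by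
  have hL1 : 1 ≤ L := le_trans (by norm_num) hL
  have hd1 : 1 ≤ d := le_trans (by norm_num) hd2
  obtain ⟨cw, hcw, hwin⟩ := prop3_windows hd2 hL hB₀.le
  refine ⟨min cB9 cw, lt_min hcB9 hcw, ?_⟩
  intro η hη k hk a M ρ hρL hρM hM SB9D U₀ hU₀ α₀ hα hα3 hα2 Ω hA hT hsmall hc₀ hc₂ h61 hsmall₁ u hu huS h129 hLan h162
  have hρ : 1 ≤ ρ := hL1.trans hρL
  have hM1 : 1 ≤ M := hρ.trans hρM
  have hLr : (1 : ℝ) ≤ L := by exact_mod_cast hL1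
  have hdpos : (0 : ℝ) < d := by exact_mod_cast hd1
  have hMpos : (0 : ℝ) < M := by exact_mod_cast hM1
  set α₀' : ℝ := (L : ℝ) ^ 3 * α₀ with hα₀'_def
  set α₁' : ℝ := 6 * d * (L : ℝ) ^ 2 * M * α₀ with hα₁'_def
  set α₂ : ℝ := 5 * (d : ℝ) * L * B₀ * ((L : ℝ) ^ 3 * α₀ + 6 * d * (L : ℝ) ^ 2 * M * α₀) with hα₂_def
  have hα₀' : 0 < α₀' := by positivity
  have hα₁' : 0 < α₁' := by positivity
  have hα₂ : 0 < α₂ := by positivity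
  obtain ⟨hα3', hα4', h16, hd5, hsm, hc₃, hside, h50, hC⟩ :=
    hwin α₀' α₂ hα₀' (hc₀.trans (min_le_right _ _)) hα₂.le (hc₂.trans (min_le_right _ _))
  have hC₂' := hC.trans hC₂
  set U'' := cutFixed L (tLo a ρ) (tHi a M ρ) U₀ k (ctr a M) with hU''
  obtain ⟨hmem, h33, h34, -, -, -⟩ := thm4_hypotheses_one_cutFixed L hL hd1 k U₀ hU₀ hα hα3 hα2 a hρ hρM hM hη hA hT hsmall
  have hone : ∀ x κ, (1 : Site d → Fin d → 𝔸ˣ) x κ ∈ unitaryUnits 𝔸 := fun _ _ => (unitaryUnits 𝔸).one_mem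
  have hui : ∀ x, u⁻¹ x ∈ U1 𝔸 := fun x => unitaryUnits_le_U1 ((unitaryUnits 𝔸).inv_mem (hu x))
  have hU₁u : ∀ x κ, gaugeAct u⁻¹ U'' x κ ∈ unitaryUnits 𝔸 := gaugeAct_mem_of hmem fun x => (unitaryUnits 𝔸).inv_mem (hu x)
  set W : Site d → Fin d → 𝔸ˣ := gaugeAct u⁻¹ U'' with hW_def
  set A : Site d → Fin d → 𝔸 := mlogCfg k η (cubeFam false L a M ρ k) W with hA_def
  -- the canonical exponent: Hermitian, (1.41), `W = e^{iηA}` on the `E j`, `0` off them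
  obtain ⟨hAsa, hrep, hA0⟩ := mlogCfg_spec hη hL1 k (1 : Site d → Fin d → 𝔸ˣ) hU₁u hα₂.le h16 (cubeFam false L a M ρ k)
    (fun j hj y τ hs => ⟨(h162 j hj (y, τ) hs).1, (h162 j hj (y, τ) hs).2.2⟩)
  have h41 : ∀ j, j ≤ k → ∀ (y : Site d) (τ : Fin d), SideTouches (cubeFam false L a M ρ k j) y τ →
      W y τ = cfgExp η A y τ ∧ ‖A y τ‖ ≤ α₂ * ((L : ℝ) ^ j * η)⁻¹ := fun j hj y τ hs =>
    ⟨(hrep j hj y τ hs).2, by rw [hA_def, (hrep j hj y τ hs).1]; exact (h162 j hj (y, τ) hs).2.2⟩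
  have h41' : ∀ j, j ≤ k → ∀ (y : Site d) (τ : Fin d), SideTouches (cubeFam false L a M ρ k j) y τ →
      ‖A y τ‖ ≤ α₂ * ((L : ℝ) ^ j * η)⁻¹ := fun j hj y τ hs => (h41 j hj y τ hs).2
  -- (1.40)₂ for `W·1` by gauge invariance from (1.132), and for `e^{iηA}·1` by locality
  have hW₀ : mulCfg U'' (1 : Site d → Fin d → 𝔸ˣ) = U'' := mul_one _
  have hW₁ : mulCfg W (1 : Site d → Fin d → 𝔸ˣ) = W := mul_one _
  have hPair : InAk L k η α₀' (cubeFam false L a M ρ k) (mulCfg W (1 : Site d → Fin d → 𝔸ˣ)) := by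
    rw [hW₁, hW_def, inAk_gaugeAct_iff L k η _ _ hui]
    rw [hW₀] at h34
    exact h34
  have h40₁ : InAk L k η α₀' (cubeFam false L a M ρ k) (mulCfg (expCfg (iEta η A)) (1 : Site d → Fin d → 𝔸ˣ)) := by
    refine (inAk_congr_of_sideTouches L k η α₀' (V := mulCfg W (1 : Site d → Fin d → 𝔸ˣ)) fun j hj y τ hs => ?_).1 hPair
    show W y τ * (1 : Site d → Fin d → 𝔸ˣ) y τ = expCfg (iEta η A) y τ * (1 : Site d → Fin d → 𝔸ˣ) y τ
    rw [(h41 j hj y τ hs).1, expCfg_iEta_eq_cfgExp]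
  have hAglob : ∀ y τ, ‖A y τ‖ ≤ α₂ * η⁻¹ := by
    intro y τ
    by_cases hmem' : ∃ j, j ≤ k ∧ SideTouches (cubeFam false L a M ρ k j) y τ
    · obtain ⟨j, hj, hs⟩ := hmem'
      have hLj : (1 : ℝ) ≤ (L : ℝ) ^ j := one_le_pow₀ hLr
      calc ‖A y τ‖ ≤ α₂ * ((L : ℝ) ^ j * η)⁻¹ := h41' j hj y τ hs
        _ = α₂ * η⁻¹ * ((L : ℝ) ^ j)⁻¹ := by rw [mul_inv]; ring
        _ ≤ α₂ * η⁻¹ * 1 := by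
            apply mul_le_mul_of_nonneg_left (inv_le_one_of_one_le₀ hLj) (by positivity)
        _ = α₂ * η⁻¹ := mul_one _
    · rw [hA_def, hA0 y τ fun j hj hs => hmem' ⟨j, hj, hs⟩, norm_zero]
      positivity
  have hgrad : ∀ (y : Site d) (κ τ : Fin d), ‖covDerivFwd η (1 : Site d → Fin d → 𝔸ˣ) κ (fun z => A z τ) y‖ ≤ 2 * α₂ * η⁻¹ * η⁻¹ := by
    intro y κ τ
    unfold covDerivFwd
    rw [norm_smul, norm_inv, Real.norm_eq_abs, abs_of_pos hη]
    have h1 : ‖B7Eq78Linearization.conjR ((1 : Site d → Fin d → 𝔸ˣ) y κ) (A (y + e κ) τ) - A y τ‖ ≤ α₂ * η⁻¹ + α₂ * η⁻¹ := by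
      calc ‖B7Eq78Linearization.conjR ((1 : Site d → Fin d → 𝔸ˣ) y κ) (A (y + e κ) τ) - A y τ‖
          ≤ ‖B7Eq78Linearization.conjR ((1 : Site d → Fin d → 𝔸ˣ) y κ) (A (y + e κ) τ)‖ + ‖A y τ‖ := norm_sub_le _ _
        _ ≤ α₂ * η⁻¹ + α₂ * η⁻¹ := by
            rw [B8Ineq132.norm_conjR (unitaryUnits_le_U1 (hone y κ))]
            exact add_le_add (hAglob _ _) (hAglob _ _)
    calc η⁻¹ * ‖B7Eq78Linearization.conjR ((1 : Site d → Fin d → 𝔸ˣ) y κ) (A (y + e κ) τ) - A y τ‖ ≤ η⁻¹ * (α₂ * η⁻¹ + α₂ * η⁻¹) :=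
        mul_le_mul_of_nonneg_left h1 (by positivity)
      _ = 2 * α₂ * η⁻¹ * η⁻¹ := by ring
  have hBg : Bdd L k η (-(2 : ℝ)) (fun j (t : Fin d × Fin d × Site d) => SideTouches (cubeFam false L a M ρ k j) t.2.2 t.2.1)
      (fun t => covDerivFwd η (1 : Site d → Fin d → 𝔸ˣ) t.1 (fun z => A z t.2.1) t.2.2) := by
    have e2 : (-(2 : ℝ)) = -((2 : ℕ) : ℝ) := by norm_num
    rw [e2]
    refine B8ScaledSupNorm.bdd_of_forall (c := 2 * α₂ * ((L : ℝ) ^ k) ^ 2) fun j hj t _ => ?_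
    rw [B8ScaledSupNorm.weight_neg_natCast L η 2 j]
    have hLjk : (L : ℝ) ^ j ≤ (L : ℝ) ^ k := pow_le_pow_right₀ hLr hj
    have hLj0 : (0 : ℝ) ≤ (L : ℝ) ^ j := by positivity
    calc ((L : ℝ) ^ j * η) ^ 2 * ‖covDerivFwd η (1 : Site d → Fin d → 𝔸ˣ) t.1 (fun z => A z t.2.1) t.2.2‖
        ≤ ((L : ℝ) ^ j * η) ^ 2 * (2 * α₂ * η⁻¹ * η⁻¹) := mul_le_mul_of_nonneg_left (hgrad _ _ _) (by positivity)
      _ = 2 * α₂ * ((L : ℝ) ^ j) ^ 2 := by field_simp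
      _ ≤ 2 * α₂ * ((L : ℝ) ^ k) ^ 2 := by gcongr
  set g : ℝ := msup L k η (-(2 : ℝ)) (fun j (t : Fin d × Fin d × Site d) => SideTouches (cubeFam false L a M ρ k j) t.2.2 t.2.1)
      (fun t => covDerivFwd η (1 : Site d → Fin d → 𝔸ˣ) t.1 (fun z => A z t.2.1) t.2.2) with hg_def
  have hg0 : 0 ≤ g := B8ScaledSupNorm.msup_nonneg L k hη.le _ _ _
  have hg : ∀ j, j ≤ k → ∀ (y : Site d) (κ τ : Fin d), SideTouches (cubeFam false L a M ρ k j) y τ →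
      ((L : ℝ) ^ j * η) ^ 2 * ‖covDerivFwd η (1 : Site d → Fin d → 𝔸ˣ) κ (fun z => A z τ) y‖ ≤ g := by
    intro j hj y κ τ hs
    have h := B8ScaledSupNorm.weight_mul_norm_le_msup hBg hj (i := (κ, τ, y)) hs
    have hw : weight L η (-(2 : ℝ)) j = ((L : ℝ) ^ j * η) ^ 2 := by
      have e2 : (-(2 : ℝ)) = -((2 : ℕ) : ℝ) := by norm_num
      rw [e2, B8ScaledSupNorm.weight_neg_natCast L η 2 j]
    rw [hw] at h
    exact h
  -- the in-edge (1.59), five lines, from the socket AT THE MEMBER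
  obtain ⟨h59a, h59g, h59j, h59l, -⟩ := SB9D α₀' α₂ hα₀' (hc₀.trans (min_le_left _ _)) hα₂ (hc₂.trans (min_le_left _ _))
    (1 : Site d → Fin d → 𝔸ˣ) W hone hU₁u h33 hPair hLan A hAsa h41 hA0
  -- (1.42)₂ at all levels (`c137_cubeMember`) and the boxes of the constraint bonds
  have h42 := c137_cubeMember hd2 hL hk U₀ hU₀ hα hα3 hα2 a hρL hρM hM hη hA hT hsmall hα₂.le hα3' hα4' h16 hsm hc₃ hsmall₁ u hu
    h129 h162
  have hbox : ∀ j, j ≤ k → ∀ c ∈ cubeLamB L a M ρ k k j, ∀ x, InBox (loK L j c.1) (bondHiK L j c.1 c.2) x → x ∈ cubeFam false L a M ρ k j :=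
    fun j hj c hc x hx => hbox_cubeLamB L a M ρ k k le_rfl j hj c hc x hx
  -- THE EXTERIOR-COLLAR TERM AT THE CUBE DATUM: on a bond with both end-points outside `□₀`, `W = U₀″` (`u = 1` there), so
  -- `η‖A‖ = ‖log U₀″‖ ≤ 2·6dL²Mα₀` by (1.133)₀ read on every bond (`norm_cutFixed_sub_one_le`)
  set Φ₀ : ℝ := msup L k η (-(1 : ℝ))
      (fun j (b : Site d × Fin d) => j = 0 ∧ SideTouches ((cubeFam false L a M ρ k) 0) b.1 b.2 ∧ ¬ BondTouches ((cubeFam false L a M ρ k) 0) b.1 b.2)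
      (fun b => A b.1 b.2) with hΦ₀_def
  have hΦ₀ : Φ₀ ≤ 2 * α₁' := by
    refine B8ScaledSupNorm.msup_le (by positivity) fun j hj b hb => ?_
    obtain ⟨rfl, hsd, hnb⟩ := hb
    have e1 : (-(1 : ℝ)) = -((1 : ℕ) : ℝ) := by norm_num
    rw [e1, B8ScaledSupNorm.weight_neg_natCast L η 1 0, pow_one, pow_zero, one_mul]
    have hx : b.1 ∉ cubeFam false L a M ρ k 0 := fun h => hnb (Or.inl h)
    have hxe : b.1 + e b.2 ∉ cubeFam false L a M ρ k 0 := fun h => hnb (Or.inr h)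
    have hWb : W b.1 b.2 = U'' b.1 b.2 := by
      show gaugeAct u⁻¹ U'' b.1 b.2 = U'' b.1 b.2
      simp only [gaugeAct, Pi.inv_apply, huS _ hx, huS _ hxe, inv_one, one_mul, mul_one]
    have hAb : A b.1 b.2 = logCfg η W b.1 b.2 := mlogCfg_of_sideTouches η W (Nat.zero_le k) hsd
    have hUb : ‖((U'' b.1 b.2 : 𝔸ˣ) : 𝔸) - 1‖ ≤ α₁' :=
      norm_cutFixed_sub_one_le L hL hd1 (avgClosed_unitaryUnits (𝔸 := 𝔸) d L) k U₀ hU₀ hα hα3 hα2 a hρ hρM hM hA hT hsmall b.1 b.2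
    have hU1 : ‖((U'' b.1 b.2 : 𝔸ˣ) : 𝔸) - 1‖ ≤ 1 / 2 := hUb.trans (by
      have hdL1 : (1 : ℝ) ≤ (d : ℝ) * L := one_le_mul_of_one_le_of_one_le (by exact_mod_cast hd1) hLr
      have h1 : α₁' ≤ (d : ℝ) * L * α₁' := le_mul_of_one_le_left hα₁'.le hdL1
      linarith [hsmall₁])
    rw [hAb, logCfg, hWb, norm_smul, norm_smul, norm_inv, norm_inv, Complex.norm_I, inv_one, one_mul, Real.norm_eq_abs,
      abs_of_pos hη, ← mul_assoc, mul_inv_cancel₀ hη.ne', one_mul]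
    exact (MatrixLog.norm_mlog_le_two_mul hU1).trans (by linarith [hUb])
  have hΦ₀0 : 0 ≤ Φ₀ := B8ScaledSupNorm.msup_nonneg L k hη.le _ _ _
  -- the window: `2·Bbd·Φ₀ ≤ 4·Bbd·α₁′ ≤ (dL − 1)B₀(α₀′ + α₁′)`
  have hβ : Bbd * Φ₀ + Bbd * Φ₀ ≤ ((d : ℝ) * L - 1) * B₀ * (α₀' + α₁') := by
    have h1 : Bbd * Φ₀ + Bbd * Φ₀ ≤ 4 * Bbd * α₁' := by
      have h := mul_le_mul_of_nonneg_left hΦ₀ hBbd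
      linarith
    have h2 : 4 * Bbd * α₁' ≤ ((d : ℝ) * L - 1) * B₀ * α₁' := mul_le_mul_of_nonneg_right hBd hα₁'.le
    have h3 : 0 ≤ ((d : ℝ) * L - 1) * B₀ := le_trans (by positivity) hBd
    have h4 : ((d : ℝ) * L - 1) * B₀ * α₁' ≤ ((d : ℝ) * L - 1) * B₀ * (α₀' + α₁') :=
      mul_le_mul_of_nonneg_left (le_add_of_nonneg_left hα₀'.le) h3
    linarith
  -- PROPOSITION 3 at `k` levels with the allowances (this seat's `B8Prop3KLevelBdry`), then the slack absorbs them
  have hL1' : 1 ≤ L := hL1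
  have h₀ : ∀ y κ, (1 : Site d → Fin d → 𝔸ˣ) y κ ∈ U1 𝔸 := fun y κ => unitaryUnits_le_U1 (hone y κ)
  have h55 := B8Eq155KLevelLocal.eq155_norm_kLevel_hermitian hη hL1 h₀ hAsa hα₀'.le hα₂.le h16 hd5 hg0 h33 h40₁ h41' hg
  have h41'' : ∀ j, j ≤ k → ∀ x μ, BondTouches (cubeFam false L a M ρ k j) x μ → ‖A x μ‖ ≤ α₂ * ((L : ℝ) ^ j * η)⁻¹ :=
    fun j hj x μ hb => B8Prop3KLevel.bound_of_sideTouches hd2 (h41' j hj) x μ hb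
  have h56 := B8Eq156KLevelLocal.wsup_B1_le_kLevel hη L hL (avgClosed_unitaryUnits d L) (1 : Site d → Fin d → 𝔸ˣ) hone hα₀' hα3' hα4' A
    hα₂.le hsm hc₃ hbox h33 h41'' hα₁'.le h42
  obtain ⟨-, hg', hj', hl'⟩ := B8Prop3KLevelBdry.apriori_160_bdry (Nat.cast_nonneg d) hB₀.le hα₂.le hg0 h55 h56 h59a h59g h59j h59l hside h50
  have hK : 2 * (8 * (131072 * ((d : ℝ) + 1) ^ 2) * Real.exp (4 * (800 * ((d : ℝ) + 1) ^ 2 * ((d : ℝ) + 4)) * α₀')) * α₂ ^ 2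
      ≤ 2 * C₂ * α₂ ^ 2 := by
    have h := mul_le_mul_of_nonneg_right hC₂' (sq_nonneg α₂)
    linarith
  have hR : B₀ * (4 * α₀' + 4 * d * L * α₁' + 2 * α₂ ^ 2 + 20 * d * α₀' * α₂
      + 2 * (8 * (131072 * ((d : ℝ) + 1) ^ 2) * Real.exp (4 * (800 * ((d : ℝ) + 1) ^ 2 * ((d : ℝ) + 4)) * α₀')) * α₂ ^ 2)
      ≤ B₀ * (4 * α₀' + 4 * d * L * α₁' + 2 * α₂ ^ 2 + 20 * d * α₀' * α₂ + 2 * C₂ * α₂ ^ 2) :=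
    mul_le_mul_of_nonneg_left (by linarith [hK]) hB₀.le
  have hdL : (1 : ℝ) ≤ (d : ℝ) * L := one_le_mul_of_one_le_of_one_le (by exact_mod_cast hd1) hLr
  have h162 := B8Prop3KLevelBdry.apriori_162_bdry (C₂ := C₂) (α₂ := α₂) hB₀.le hdL hα₀'.le h61 hβ
  have e5 : 5 * (d : ℝ) * L * B₀ * (α₀' + α₁') = α₂ := by simp only [hα₀'_def, hα₁'_def, hα₂_def]
  refine ⟨?_, ?_, ?_⟩
  · linarith [hg', hR, h162, e5]
  · linarith [hj', hR, h162, e5]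
  · linarith [hl', hR, h162, e5]

#print axioms norms136_cubeMember_at_bdry

end Literature.MathematicalPhysics.QuantumFieldTheory.Balaban1983to89.B8Prop6CubeMemberNormsBdry

end
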